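import Summits.QuantumFields.YangMills.Theorems.UV3BranchExpansionTrajectorySupport
import Summits.QuantumFields.YangMills.Theorems.UV3BranchExpansionOneSlotField
import HarnessLib

/-!
# R3 (cell `ym3-torus`, YM₃ on T³ — a ladder RUNG, NOT d = 4, NOT infinite volume, NOT a mass gap, NOT the Clay problem) —
# **(F-M2b) THE MUTE CANCELLATION: flipping the branch at a MUTE switch site does not change the guarded, tested push-forward —
# `∫ 1[guards of 𝐬 fire along V₊]·g(V₊ n) dU_j = ∫ 1[guards of 𝐬 fire along V₋]·g(V₋ n) dU_j` (lemma (M) of the branch expansion, def-free)**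

Width seat `ym3-torus-px8` g13 on crux `stmt-QuantumFields-19936` `UnitScaleTilt.HistoryTailL` (`--supports`, helper; THEOREMS ONLY, 0 `def`, 0 `sorry`,
default heartbeats).  Second half of (F-M2) of LEAD ★w1-19936 g12's note `Cruxes/HistoryTailL/HTopBranchExpansion.md` §4 (M) ∕ §4a (v1.2) — the EXHIBIT over the engine
✓`UV3BranchExpansionOneSlotField.lintegral_fieldMeasure_oneSlot_eq` (p759758) and the support ✓`UV3BranchExpansionTrajectorySupport` ((F-M2a)).  It discharges, for ONE mute
site, the hypothesis `hM` of the (E)-model socket `UV3BranchExpansionGuardedTower.map_iterFrom_le_smul_of_branchExpansion` (LEAD).  RECORD CURRENCY: record-independent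
kinematics; read by no row of the χ record `AlphaInputsT3ACv4RecChi`; nothing of hTop, of the record, of `HistoryTailL` or of rung R3 is proved here.

SETTING (relative heights `i` over the base level `j`, top height `n`, `j + n` in the standing range; all families HYPOTHESIS-SPECIFIED):
* two step-slice families `S₁ S₂ : (i : ℕ) → Finset (PBond P (j+i+1))` (the EML branches of the histories `𝐬′ ∪ {σ}` and `𝐬′`) which AGREE except at the bond `c` of height
  `κ` (`σ = (κ, c)`), both inside the CONSTRAINED slices `Sc i` (the guards of `𝐬`, which must fire); their trajectories `V₁ V₂` (`hV0`, `hVs` as in (F-M2a) ∕ the socket);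
* the MUTENESS of `σ` in lattice letters (✓`UV3BranchExpansionDistortedSet` §2–§3 produce them): the Dist-TOWER `t (κ+1) = c, t i = line (t (i+1)) (τ i)` (`κ+1 ≤ i ≤ m`),
  its bonds UNREAD by the constrained guards of their height, ending below the top (`m + 1 ≤ n`); the EXIT CHAIN `b (m+1) = t (m+1), b i = line (b (i+1)) (τ′ i)` (`i ≤ m`)
  of unread bonds with AXIAL parents down to the private bottom slot `b⁰ := b 0` (✓`…DistortedSet.exists_exit_chain`, re-indexed `i ↦ j + i`).
THE INTEGRANDS `J_ℓ U := 1[∀ i < n, ∀ c′ ∈ Sc i, Small ℰ (V_ℓ i U) c′] · g (V_ℓ n U)` (`g ≥ 0` measurable on the top fields).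

CONTENTS.
* §1 `traj_congr_above` (equal at `n₀` + equal slices above ⇒ equal above); ★ `traj_congr_off_chain_tower` (the COMBINED cone: slot perturbed AND branch flipped).
* §2 THE EXHIBIT: with `L₁, R₁` from ✓`exists_oneSlot_of_chain` for `V₁`, **`Ψ h U := J₁ (U[b⁰ ↦ (L₁ U)⁻¹·h·(R₁ U)⁻¹])`** — the integrand `J₁` re-evaluated on the input whose
  private slot is tuned so that `V₁ (m+1) · (t (m+1)) = h`; ★ `J₁ U = Ψ (V₁ (m+1) U (t (m+1))) U`, ★ `Ψ h (U[b⁰ ↦ g′]) = Ψ h U`, ★★ `J₂ U = Ψ (V₂ (m+1) U (t (m+1))) U` (the combined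
  cone up to `m+1`, the tuned slot, `traj_congr_above` beyond, unread guards below).  No restart family, no definition.
* §3 ★★★ `lintegral_guardAll_mul_eq_of_mute` — **`∫⁻ J₁ dU_j = ∫⁻ J₂ dU_j`** (the engine twice: both sides equal `∫∫ Ψ h U dHaar(h) dU_j`); ★★★ `measure_guardAll_inter_preimage_eq_of_mute`
  — the SET form `dU_j ({guards of Sc fire along V₁} ∩ V₁ n ⁻¹' B) = dU_j ({… V₂} ∩ V₂ n ⁻¹' B)`.
* §4 ★★★ `socket_hM_of_mute` — THE SAME IN THE SOCKET'S OWN LETTERS (histories = finsets of `Σ i : Fin n, PBond P (j+i+1)`, `V s`, `hV0`∕`hVs` verbatim as in LEAD's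
  ✓`UV3BranchExpansionGuardedTower.map_iterFrom_le_smul_of_branchExpansion`): for `s′ ⊆ s`, `σ = ⟨⟨κ,hκ⟩,c⟩ ∈ s ∖ s′` mute (tower ∕ chain data indexed against `s`),
  `dU_j ((⋂ τ ∈ s, {U | Small ℰ (V (insert σ s′) τ.1 U) τ.2}) ∩ V (insert σ s′) n ⁻¹' B) = dU_j ((⋂ τ ∈ s, {…V s′…}) ∩ V s′ n ⁻¹' B)` — the `hM` binder, per mute site.

HONEST SCOPE.  [folklore] measure theory over p759758 and (F-M2a) BY NAME; 0 `def`, 0 `instance`, standard axioms.  The muteness enters as displayed lattice HYPOTHESES (tower ∕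
chain ∕ unread ∕ axial; produced by ✓`UV3BranchExpansionDistortedSet` + the (F-TOP) adapter); the count is (C′) (w2 g17), the activity (A) (w8 ∕ LEAD).  Nothing of hTop ∕ the χ
record ∕ (O‴χₛ) ∕ `HistoryTailL` (19936) ∕ rung R3 is proved; R3 = SU(2) YM₃ on T³ — NOT d = 4, NOT infinite volume, NOT a mass gap, NOT Clay; the YM mass gap is NOT proved.
References: T. Bałaban, Commun. Math. Phys. **109** (1987) 249–301 [Balaban1987RG1] ((0.4) p. 253); T. Bałaban, Commun. Math. Phys. **95** (1984) 17–40
[Balaban1984PropagatorsI] ((1.7) p. 18); LEAD note `Cruxes/HistoryTailL/HTopBranchExpansion.md` §4 (M), §4a.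
-/

set_option autoImplicit false

noncomputable section
open MeasureTheory Function
open scoped ENNReal

namespace Summit.QuantumFields.YangMills.Theorems.UV3BranchExpansionMuteCancellation

open Literature.MathematicalPhysics.QuantumFieldTheory.Balaban1983to89
open Literature.MathematicalPhysics.QuantumFieldTheory.Balaban1983to89.AveragingRT
open Literature.MathematicalPhysics.QuantumFieldTheory.Balaban1983to89.T4Continuum (walk loopWord)
open Literature.MathematicalPhysics.QuantumFieldTheory.Balaban1983to89.BlockAveraging (Idx off Small avgFun measurableSet_small)
open Summit.QuantumFields.YangMills.Theorems.UV3BranchExpansionTrajectorySupport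
open Summit.QuantumFields.YangMills.Theorems.UV3AxialLaunderingFreeSlot (line_inj)
open Summit.QuantumFields.YangMills.Theorems.UV3BranchExpansionOneSlotField (lintegral_fieldMeasure_oneSlot_eq)

variable {P : Params} {G : Type*} [GaugeGroup G] (ℰ : LoopAverage G) [∀ k, DecidableEq (PBond P k)] {j n : ℕ}

/-! ## §1 Two more agreement lemmas -/
section Agreement

/-- **EQUAL AT HEIGHT `n₀`, EQUAL SLICES ABOVE ⇒ EQUAL ABOVE**: two trajectories with the same slices at the heights `n₀ ≤ i < n` which coincide at height `n₀` (on possibly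
different inputs) coincide at every height `n₀ ≤ i ≤ n`. [folklore] -/
theorem traj_congr_above (S₁ S₂ : (i : ℕ) → Finset (PBond P (j + i + 1))) (V₁ V₂ : (i : ℕ) → GaugeField P j G → GaugeField P (j + i) G)
    (hV₁s : ∀ i, i < n → ∀ U, V₁ (i + 1) U = fun C => if C ∈ S₁ i then avgFun ℰ (V₁ i U) C else axialAvg (V₁ i U) C)
    (hV₂s : ∀ i, i < n → ∀ U, V₂ (i + 1) U = fun C => if C ∈ S₂ i then avgFun ℰ (V₂ i U) C else axialAvg (V₂ i U) C)
    {n₀ : ℕ} (hS : ∀ i, n₀ ≤ i → i < n → S₁ i = S₂ i) {U₁ U₂ : GaugeField P j G} (h₀ : V₁ n₀ U₁ = V₂ n₀ U₂) :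
    ∀ i, n₀ ≤ i → i ≤ n → V₁ i U₁ = V₂ i U₂ := by
  intro i hi
  induction i, hi using Nat.le_induction with
  | base => intro _; exact h₀
  | succ i hi ih =>
    intro hin
    have hi' : i < n := Nat.lt_of_succ_le hin
    rw [hV₁s i hi', hV₂s i hi', ih hi'.le, hS i hi hi']

/-- ★ **THE COMBINED CONE**: inputs differing only at the bottom slot `b 0` of an unread chain with axial parents, slices differing only at the bond `c = t (κ+1)` under an
unread tower — the two trajectories agree off `{b i} ∪ {t i | κ+1 ≤ i}` at every height `i ≤ N` (✓`traj_congr_off_cone`). [cite: Balaban1987RG1, (0.4) p.253] -/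
theorem traj_congr_off_chain_tower (S₁ S₂ : (i : ℕ) → Finset (PBond P (j + i + 1))) (V₁ V₂ : (i : ℕ) → GaugeField P j G → GaugeField P (j + i) G)
    (hV₁0 : ∀ U, V₁ 0 U = U) (hV₂0 : ∀ U, V₂ 0 U = U) {N : ℕ}
    (hV₁s : ∀ i, i < N → ∀ U, V₁ (i + 1) U = fun C => if C ∈ S₁ i then avgFun ℰ (V₁ i U) C else axialAvg (V₁ i U) C)
    (hV₂s : ∀ i, i < N → ∀ U, V₂ (i + 1) U = fun C => if C ∈ S₂ i then avgFun ℰ (V₂ i U) C else axialAvg (V₂ i U) C)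
    (hN : j + N ≤ P.m + P.K) {κ : ℕ} (c : PBond P (j + κ + 1))
    (hs : ∀ i, i ≠ κ → S₁ i = S₂ i) (hsκ : ∀ C : PBond P (j + κ + 1), C ≠ c → (C ∈ S₁ κ ↔ C ∈ S₂ κ))
    (t : (i : ℕ) → PBond P (j + i)) (τ : ℕ → ℕ) (htc : t (κ + 1) = c)
    (htower : ∀ i, κ + 1 ≤ i → i < N → τ i < P.L ∧ t i = line (t (i + 1)) (τ i))
    (htunread : ∀ i, κ + 1 ≤ i → i < N → ∀ C ∈ S₁ i, ∀ (ι : Idx P), ∀ st ∈ walk (emb C.src) (loopWord P.L C.dir (off ι.1) ι.2.1 ι.2.2), st.bond ≠ t i)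
    (b : (i : ℕ) → PBond P (j + i)) (τ' : ℕ → ℕ) (hchain : ∀ i, i < N → τ' i < P.L ∧ b i = line (b (i + 1)) (τ' i))
    (hbunread : ∀ i, i < N → ∀ C ∈ S₁ i, ∀ (ι : Idx P), ∀ st ∈ walk (emb C.src) (loopWord P.L C.dir (off ι.1) ι.2.1 ι.2.2), st.bond ≠ b i)
    (U : GaugeField P j G) (g : G) :
    ∀ i, i ≤ N → ∀ C, C ≠ b i → (κ + 1 ≤ i → C ≠ t i) → V₁ i (update U (b 0) g) C = V₂ i U C := by
  have h := traj_congr_off_cone ℰ S₁ S₂ V₁ V₂ hV₁0 hV₂0 hV₁s hV₂s (fun i => {C | C = b i ∨ (κ + 1 ≤ i ∧ C = t i)}) (U₁ := update U (b 0) g) (U₂ := U) (N := N)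
    (fun C hC => update_of_ne (fun hCb => hC (Or.inl hCb)) g U) ?_
  · intro i hi C hCb hCt
    exact h i hi C fun hmem => hmem.elim hCb fun h2 => hCt h2.1 h2.2
  intro i hi C hC'
  have hCb : C ≠ b (i + 1) := fun h1 => hC' (Or.inl h1)
  have hCt : ∀ h1 : κ + 1 ≤ i + 1, C ≠ t (i + 1) := fun h1 h2 => hC' (Or.inr ⟨h1, h2⟩)
  refine ⟨?_, ?_, ?_⟩
  · by_cases hiκ : i = κ
    · subst hiκ
      exact hsκ C fun hCc => hCt le_rfl (by rw [htc]; exact hCc)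
    · rw [hs i hiκ]
  · rintro t' ht' (hmem | ⟨hi1, hmem⟩)
    · obtain ⟨hτ, hb⟩ := hchain i hi
      have hmem' : line C t' = line (b (i + 1)) (τ' i) := by rw [← hb]; exact hmem
      exact hCb (line_inj (j := j + i) (show j + i + 1 ≤ P.m + P.K by omega) ht' hτ hmem').1
    · obtain ⟨hτ, hti⟩ := htower i hi1 hi
      have hmem' : line C t' = line (t (i + 1)) (τ i) := by rw [← hti]; exact hmem
      exact hCt (by omega) (line_inj (j := j + i) (show j + i + 1 ≤ P.m + P.K by omega) ht' hτ hmem').1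
  · rintro hCs ι st hst (hmem | ⟨hi1, hmem⟩)
    · exact hbunread i hi C hCs ι st hst hmem
    · exact htunread i hi1 hi C hCs ι st hst hmem

end Agreement

/-! ## §2–§3 The exhibit and the cancellation -/
section Cancellation

variable [MeasurableSpace G] [RegularGaugeGroup G] [HaarData G]

/-- ★★★ **THE MUTE CANCELLATION, INTEGRAL FORM** (lemma (M) of the branch expansion).  Two histories whose EML slices `S₁, S₂ ⊆ Sc` differ only at the bond `c` of height `κ`;
`σ = (κ, c)` MUTE: a Dist-tower `t (κ+1) = c, …, t m` of bonds unread by the constrained guards `Sc` with axial parents, `t (m+1)` its first bond outside `Dist`, `m + 1 ≤ n`, and an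
exit chain `b (m+1) = t (m+1), …, b 0` of unread bonds with axial parents.  Then for every measurable `g ≥ 0` on the top fields
**`∫⁻ 1[∀ i<n, ∀ c′ ∈ Sc i, Small ℰ (V₁ i U) c′]·g (V₁ n U) dU_j = ∫⁻ 1[∀ i<n, ∀ c′ ∈ Sc i, Small ℰ (V₂ i U) c′]·g (V₂ n U) dU_j`**.
PROOF: `Ψ h U := J₁ (U[b 0 ↦ (L₁ U)⁻¹·h·(R₁ U)⁻¹])` with `L₁, R₁` of ✓`exists_oneSlot_of_chain`; `J_ℓ U = Ψ (L_ℓ U·U(b 0)·R_ℓ U) U` (the combined cone + `traj_congr_above`), `Ψ h ·`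
invariant under the slot; LEAD's engine ✓`lintegral_fieldMeasure_oneSlot_eq` twice. [cite: Balaban1987RG1, (0.4) p.253] -/
theorem lintegral_guardAll_mul_eq_of_mute (hE : ∀ n, Measurable fun W : Fin (n + 1) → G => ℰ.E W)
    (Sc S₁ S₂ : (i : ℕ) → Finset (PBond P (j + i + 1))) (hS₁ : ∀ i, i < n → S₁ i ⊆ Sc i) (hS₂ : ∀ i, i < n → S₂ i ⊆ Sc i)
    (V₁ V₂ : (i : ℕ) → GaugeField P j G → GaugeField P (j + i) G) (hV₁0 : ∀ U, V₁ 0 U = U) (hV₂0 : ∀ U, V₂ 0 U = U)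
    (hV₁s : ∀ i, i < n → ∀ U, V₁ (i + 1) U = fun C => if C ∈ S₁ i then avgFun ℰ (V₁ i U) C else axialAvg (V₁ i U) C)
    (hV₂s : ∀ i, i < n → ∀ U, V₂ (i + 1) U = fun C => if C ∈ S₂ i then avgFun ℰ (V₂ i U) C else axialAvg (V₂ i U) C)
    (hjn : j + n ≤ P.m + P.K) {κ m : ℕ} (hκm : κ ≤ m) (hmn : m + 1 ≤ n) (c : PBond P (j + κ + 1))
    (hs : ∀ i, i ≠ κ → S₁ i = S₂ i) (hsκ : ∀ C : PBond P (j + κ + 1), C ≠ c → (C ∈ S₁ κ ↔ C ∈ S₂ κ))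
    (t : (i : ℕ) → PBond P (j + i)) (τ : ℕ → ℕ) (htc : t (κ + 1) = c)
    (htower : ∀ i, κ + 1 ≤ i → i < m + 1 → τ i < P.L ∧ t i = line (t (i + 1)) (τ i))
    (htunread : ∀ i, κ + 1 ≤ i → i < m + 1 → ∀ C ∈ Sc i, ∀ (ι : Idx P), ∀ st ∈ walk (emb C.src) (loopWord P.L C.dir (off ι.1) ι.2.1 ι.2.2), st.bond ≠ t i)
    (b : (i : ℕ) → PBond P (j + i)) (τ' : ℕ → ℕ) (hbt : b (m + 1) = t (m + 1))
    (hchain : ∀ i, i < m + 1 → τ' i < P.L ∧ b i = line (b (i + 1)) (τ' i))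
    (hbax₁ : ∀ i, i < m + 1 → b (i + 1) ∉ S₁ i) (hbax₂ : ∀ i, i < m + 1 → b (i + 1) ∉ S₂ i)
    (hbunread : ∀ i, i < m + 1 → ∀ C ∈ Sc i, ∀ (ι : Idx P), ∀ st ∈ walk (emb C.src) (loopWord P.L C.dir (off ι.1) ι.2.1 ι.2.2), st.bond ≠ b i)
    (g : GaugeField P (j + n) G → ℝ≥0∞) (hg : Measurable g) :
    ∫⁻ U, {U : GaugeField P j G | ∀ i, i < n → ∀ c' ∈ Sc i, Small ℰ (V₁ i U) c'}.indicator 1 U * g (V₁ n U) ∂(fieldMeasure P j G) =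
      ∫⁻ U, {U : GaugeField P j G | ∀ i, i < n → ∀ c' ∈ Sc i, Small ℰ (V₂ i U) c'}.indicator 1 U * g (V₂ n U) ∂(fieldMeasure P j G) := by
  haveI := HaarData.isProb (G := G)
  -- measurability of the trajectories and of the two integrands
  have hV₁m := measurable_traj ℰ hE S₁ V₁ hV₁0 hV₁s
  have hV₂m := measurable_traj ℰ hE S₂ V₂ hV₂0 hV₂s
  have hEv : ∀ (V : (i : ℕ) → GaugeField P j G → GaugeField P (j + i) G), (∀ i, i ≤ n → Measurable (V i)) →
      MeasurableSet {U : GaugeField P j G | ∀ i, i < n → ∀ c' ∈ Sc i, Small ℰ (V i U) c'} := by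
    intro V hV
    have : {U : GaugeField P j G | ∀ i, i < n → ∀ c' ∈ Sc i, Small ℰ (V i U) c'} =
        ⋂ i ∈ Finset.range n, ⋂ c' ∈ Sc i, V i ⁻¹' {W | Small ℰ W c'} := by
      ext U; simp only [Set.mem_setOf_eq, Set.mem_iInter, Finset.mem_range, Set.mem_preimage]
    rw [this]
    exact Finset.measurableSet_biInter _ fun i hi => Finset.measurableSet_biInter _ fun c' _ =>
      hV i (Finset.mem_range.1 hi).le (measurableSet_small ℰ c')
  set J₁ : GaugeField P j G → ℝ≥0∞ := fun U => {U : GaugeField P j G | ∀ i, i < n → ∀ c' ∈ Sc i, Small ℰ (V₁ i U) c'}.indicator 1 U * g (V₁ n U) with hJ₁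
  set J₂ : GaugeField P j G → ℝ≥0∞ := fun U => {U : GaugeField P j G | ∀ i, i < n → ∀ c' ∈ Sc i, Small ℰ (V₂ i U) c'}.indicator 1 U * g (V₂ n U) with hJ₂
  have hJ₁m : Measurable J₁ := ((measurable_one.indicator (hEv V₁ hV₁m)).mul (hg.comp (hV₁m n le_rfl)))
  -- the one-slot forms of `V_ℓ (m+1) U (t (m+1))` along the exit chain
  have hm1n : m + 1 ≤ n := hmn
  obtain ⟨L₁, R₁, hL₁m, hR₁m, hL₁i, hR₁i, hLR₁⟩ := exists_oneSlot_of_chain ℰ hE S₁ V₁ hV₁0 hV₁s hjn hm1n b τ' hchain hbax₁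
    fun i hi C hC => hbunread i hi C (hS₁ i (by omega) hC)
  obtain ⟨L₂, R₂, hL₂m, hR₂m, hL₂i, hR₂i, hLR₂⟩ := exists_oneSlot_of_chain ℰ hE S₂ V₂ hV₂0 hV₂s hjn hm1n b τ' hchain hbax₂
    fun i hi C hC => hbunread i hi C (hS₂ i (by omega) hC)
  -- THE EXHIBIT
  set Ψ : G → GaugeField P j G → ℝ≥0∞ := fun h U => J₁ (update U (b 0) ((L₁ U)⁻¹ * h * (R₁ U)⁻¹)) with hΨ
  -- (i) joint measurability
  have hΨm : Measurable fun p : G × GaugeField P j G => Ψ p.1 p.2 := by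
    have hslot : Measurable fun p : G × GaugeField P j G => (L₁ p.2)⁻¹ * p.1 * (R₁ p.2)⁻¹ :=
      (((hL₁m.comp measurable_snd).inv).mul measurable_fst).mul (hR₁m.comp measurable_snd).inv
    have hup : Measurable fun p : G × GaugeField P j G => update p.2 (b 0) ((L₁ p.2)⁻¹ * p.1 * (R₁ p.2)⁻¹) :=
      measurable_update'.comp (measurable_snd.prodMk hslot)
    exact hJ₁m.comp hup
  -- (ii) invariance of `Ψ h ·` under the private slot
  have hΨi : ∀ h U g', Ψ h (update U (b 0) g') = Ψ h U := by
    intro h U g'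
    simp only [hΨ, hL₁i, hR₁i, update_idem]
  -- (iii) `J₁ U = Ψ (V₁ (m+1) U (t (m+1))) U`
  have hJ₁Ψ : ∀ U, J₁ U = Ψ (L₁ U * U (b 0) * R₁ U) U := by
    intro U
    simp only [hΨ]
    rw [show (L₁ U)⁻¹ * (L₁ U * U (b 0) * R₁ U) * (R₁ U)⁻¹ = U (b 0) by group, update_eq_self]
  -- (iv) `J₂ U = Ψ (V₂ (m+1) U (t (m+1))) U`: the tuned input reproduces `V₂` at height `m+1`, hence above; below, the guards do not see the difference
  have hJ₂Ψ : ∀ U, J₂ U = Ψ (L₂ U * U (b 0) * R₂ U) U := by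
    intro U
    set g₂ : G := (L₁ U)⁻¹ * (L₂ U * U (b 0) * R₂ U) * (R₁ U)⁻¹ with hg₂
    set U' : GaugeField P j G := update U (b 0) g₂ with hU'
    -- agreement off the chain ∪ tower up to height `m+1`
    have hcone := traj_congr_off_chain_tower ℰ S₁ S₂ V₁ V₂ hV₁0 hV₂0 (N := m + 1) (fun i hi U => hV₁s i (by omega) U)
      (fun i hi U => hV₂s i (by omega) U) (by omega) c hs hsκ t τ htc htower
      (fun i hi1 hi C hC => htunread i hi1 hi C (hS₁ i (by omega) hC)) b τ' hchain
      (fun i hi C hC => hbunread i hi C (hS₁ i (by omega) hC)) U g₂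
    -- at the slot `t (m+1)` the tuned input reproduces `V₂`
    have hslot : V₁ (m + 1) U' (t (m + 1)) = V₂ (m + 1) U (t (m + 1)) := by
      rw [← hbt, hLR₁ U', hLR₂ U, hU', hL₁i, hR₁i, update_self, hg₂]
      group
    -- hence equality at height `m+1` …
    have hm1 : V₁ (m + 1) U' = V₂ (m + 1) U := by
      funext C
      by_cases hC : C = t (m + 1)
      · rw [hC]; exact hslot
      · exact hcone (m + 1) le_rfl C (by rw [hbt]; exact hC) (fun _ => hC)
    -- … and above
    have habove : ∀ i, m + 1 ≤ i → i ≤ n → V₁ i U' = V₂ i U :=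
      traj_congr_above ℰ S₁ S₂ V₁ V₂ hV₁s hV₂s (n₀ := m + 1) (fun i hi _ => hs i (by omega)) hm1
    -- the guard events agree
    have hguards : (∀ i, i < n → ∀ c' ∈ Sc i, Small ℰ (V₁ i U') c') ↔ (∀ i, i < n → ∀ c' ∈ Sc i, Small ℰ (V₂ i U) c') := by
      refine forall_congr' fun i => forall_congr' fun hi => forall_congr' fun c' => forall_congr' fun hc' => ?_
      rcases Nat.lt_or_ge i (m + 1) with hlt | hge
      · -- below `m+1`: agreement off the chain ∪ tower, which the guard of `c'` does not read
        refine small_congr_off ℰ {C | C = b i ∨ (κ + 1 ≤ i ∧ C = t i)} (fun C hC => ?_) c' fun ι st hst hmem => ?_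
        · simp only [Set.mem_setOf_eq, not_or, not_and] at hC
          exact hcone i hlt.le C hC.1 hC.2
        · rcases hmem with hmem | ⟨hi1, hmem⟩
          · exact hbunread i hlt c' hc' ι st hst hmem
          · exact htunread i hi1 hlt c' hc' ι st hst hmem
      · rw [habove i hge hi.le]
    simp only [hΨ, hJ₁, hJ₂]
    rw [← hg₂, ← hU', habove n hmn le_rfl]
    congr 1
    by_cases hev : ∀ i, i < n → ∀ c' ∈ Sc i, Small ℰ (V₂ i U) c'
    · rw [Set.indicator_of_mem (show U ∈ {U : GaugeField P j G | ∀ i, i < n → ∀ c' ∈ Sc i, Small ℰ (V₂ i U) c'} from hev),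
        Set.indicator_of_mem (show U' ∈ {U : GaugeField P j G | ∀ i, i < n → ∀ c' ∈ Sc i, Small ℰ (V₁ i U) c'} from hguards.2 hev),
        Pi.one_apply, Pi.one_apply]
    · rw [Set.indicator_of_notMem (show U ∉ {U : GaugeField P j G | ∀ i, i < n → ∀ c' ∈ Sc i, Small ℰ (V₂ i U) c'} from hev),
        Set.indicator_of_notMem (show U' ∉ {U : GaugeField P j G | ∀ i, i < n → ∀ c' ∈ Sc i, Small ℰ (V₁ i U) c'} from fun h => hev (hguards.1 h))]
  -- (v) the engine, twice
  have hone : Measurable fun _ : GaugeField P j G => (1 : G) := measurable_const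
  have e₁ := lintegral_fieldMeasure_oneSlot_eq (b 0) Ψ hΨm hΨi L₁ (fun _ => 1) R₁ hL₁m hone hR₁m hL₁i (fun _ _ => rfl) hR₁i
  have e₂ := lintegral_fieldMeasure_oneSlot_eq (b 0) Ψ hΨm hΨi L₂ (fun _ => 1) R₂ hL₂m hone hR₂m hL₂i (fun _ _ => rfl) hR₂i
  simp only [mul_one] at e₁ e₂
  calc ∫⁻ U, J₁ U ∂(fieldMeasure P j G) = ∫⁻ U, Ψ (L₁ U * U (b 0) * R₁ U) U ∂(fieldMeasure P j G) := lintegral_congr fun U => hJ₁Ψ U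
    _ = ∫⁻ p, Ψ p.2 p.1 ∂((fieldMeasure P j G).prod (HaarData.haar : Measure G)) := e₁
    _ = ∫⁻ U, Ψ (L₂ U * U (b 0) * R₂ U) U ∂(fieldMeasure P j G) := e₂.symm
    _ = ∫⁻ U, J₂ U ∂(fieldMeasure P j G) := lintegral_congr fun U => (hJ₂Ψ U).symm

/-- ★★★ **THE MUTE CANCELLATION, SET FORM = the socket's `hM` at one mute site**: under the hypotheses of `lintegral_guardAll_mul_eq_of_mute`, for every measurable set `B` of
top fields `dU_j ({U | ∀ i<n, ∀ c′ ∈ Sc i, Small ℰ (V₁ i U) c′} ∩ V₁ n ⁻¹' B) = dU_j ({U | … V₂ …} ∩ V₂ n ⁻¹' B)` — flipping the branch at a mute site leaves the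
constrained, tested push-forward unchanged, so the constrained set's alternating sum vanishes (✓`UV3BranchExpansionDomination.branchSum_eq_zero_of_mute`).
[cite: Balaban1987RG1, (0.4) p.253] -/
theorem measure_guardAll_inter_preimage_eq_of_mute (hE : ∀ n, Measurable fun W : Fin (n + 1) → G => ℰ.E W)
    (Sc S₁ S₂ : (i : ℕ) → Finset (PBond P (j + i + 1))) (hS₁ : ∀ i, i < n → S₁ i ⊆ Sc i) (hS₂ : ∀ i, i < n → S₂ i ⊆ Sc i)
    (V₁ V₂ : (i : ℕ) → GaugeField P j G → GaugeField P (j + i) G) (hV₁0 : ∀ U, V₁ 0 U = U) (hV₂0 : ∀ U, V₂ 0 U = U)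
    (hV₁s : ∀ i, i < n → ∀ U, V₁ (i + 1) U = fun C => if C ∈ S₁ i then avgFun ℰ (V₁ i U) C else axialAvg (V₁ i U) C)
    (hV₂s : ∀ i, i < n → ∀ U, V₂ (i + 1) U = fun C => if C ∈ S₂ i then avgFun ℰ (V₂ i U) C else axialAvg (V₂ i U) C)
    (hjn : j + n ≤ P.m + P.K) {κ m : ℕ} (hκm : κ ≤ m) (hmn : m + 1 ≤ n) (c : PBond P (j + κ + 1))
    (hs : ∀ i, i ≠ κ → S₁ i = S₂ i) (hsκ : ∀ C : PBond P (j + κ + 1), C ≠ c → (C ∈ S₁ κ ↔ C ∈ S₂ κ))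
    (t : (i : ℕ) → PBond P (j + i)) (τ : ℕ → ℕ) (htc : t (κ + 1) = c)
    (htower : ∀ i, κ + 1 ≤ i → i < m + 1 → τ i < P.L ∧ t i = line (t (i + 1)) (τ i))
    (htunread : ∀ i, κ + 1 ≤ i → i < m + 1 → ∀ C ∈ Sc i, ∀ (ι : Idx P), ∀ st ∈ walk (emb C.src) (loopWord P.L C.dir (off ι.1) ι.2.1 ι.2.2), st.bond ≠ t i)
    (b : (i : ℕ) → PBond P (j + i)) (τ' : ℕ → ℕ) (hbt : b (m + 1) = t (m + 1))
    (hchain : ∀ i, i < m + 1 → τ' i < P.L ∧ b i = line (b (i + 1)) (τ' i))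
    (hbax₁ : ∀ i, i < m + 1 → b (i + 1) ∉ S₁ i) (hbax₂ : ∀ i, i < m + 1 → b (i + 1) ∉ S₂ i)
    (hbunread : ∀ i, i < m + 1 → ∀ C ∈ Sc i, ∀ (ι : Idx P), ∀ st ∈ walk (emb C.src) (loopWord P.L C.dir (off ι.1) ι.2.1 ι.2.2), st.bond ≠ b i)
    {B : Set (GaugeField P (j + n) G)} (hB : MeasurableSet B) :
    fieldMeasure P j G ({U : GaugeField P j G | ∀ i, i < n → ∀ c' ∈ Sc i, Small ℰ (V₁ i U) c'} ∩ V₁ n ⁻¹' B) =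
      fieldMeasure P j G ({U : GaugeField P j G | ∀ i, i < n → ∀ c' ∈ Sc i, Small ℰ (V₂ i U) c'} ∩ V₂ n ⁻¹' B) := by
  have hV₁m := measurable_traj ℰ hE S₁ V₁ hV₁0 hV₁s
  have hV₂m := measurable_traj ℰ hE S₂ V₂ hV₂0 hV₂s
  have hEv : ∀ (V : (i : ℕ) → GaugeField P j G → GaugeField P (j + i) G), (∀ i, i ≤ n → Measurable (V i)) →
      MeasurableSet {U : GaugeField P j G | ∀ i, i < n → ∀ c' ∈ Sc i, Small ℰ (V i U) c'} := by
    intro V hV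
    have : {U : GaugeField P j G | ∀ i, i < n → ∀ c' ∈ Sc i, Small ℰ (V i U) c'} =
        ⋂ i ∈ Finset.range n, ⋂ c' ∈ Sc i, V i ⁻¹' {W | Small ℰ W c'} := by
      ext U; simp only [Set.mem_setOf_eq, Set.mem_iInter, Finset.mem_range, Set.mem_preimage]
    rw [this]
    exact Finset.measurableSet_biInter _ fun i hi => Finset.measurableSet_biInter _ fun c' _ =>
      hV i (Finset.mem_range.1 hi).le (measurableSet_small ℰ c')
  -- `μ (E ∩ V⁻¹ B) = ∫ 1_E · 1_B ∘ V`
  have key : ∀ (V : (i : ℕ) → GaugeField P j G → GaugeField P (j + i) G), (∀ i, i ≤ n → Measurable (V i)) →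
      fieldMeasure P j G ({U : GaugeField P j G | ∀ i, i < n → ∀ c' ∈ Sc i, Small ℰ (V i U) c'} ∩ V n ⁻¹' B) =
        ∫⁻ U, {U : GaugeField P j G | ∀ i, i < n → ∀ c' ∈ Sc i, Small ℰ (V i U) c'}.indicator 1 U * B.indicator 1 (V n U) ∂(fieldMeasure P j G) := by
    intro V hV
    rw [← lintegral_indicator_one ((hEv V hV).inter (hV n le_rfl hB))]
    refine lintegral_congr fun U => ?_
    rw [Set.inter_indicator_one]
    rfl
  rw [key V₁ hV₁m, key V₂ hV₂m]
  exact lintegral_guardAll_mul_eq_of_mute ℰ hE Sc S₁ S₂ hS₁ hS₂ V₁ V₂ hV₁0 hV₂0 hV₁s hV₂s hjn hκm hmn c hs hsκ t τ htc htower htunread b τ' hbt hchain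
    hbax₁ hbax₂ hbunread (B.indicator 1) (measurable_one.indicator hB)

end Cancellation

/-! ## §4 The socket's `hM` letter at one mute site (LEAD ★w1 g12's `UV3BranchExpansionGuardedTower`, verbatim shapes) -/
section Socket

variable [MeasurableSpace G] [RegularGaugeGroup G] [HaarData G]

/-- ★★★ **`hM` OF THE (E)-MODEL SOCKET AT ONE MUTE SITE, IN THE SOCKET'S OWN LETTERS.**  Histories are finsets of switch sites `σ : Σ i : Fin n, PBond P (j+i+1)`; `V s` is the
hybrid trajectory of the history `s` (`hV0`, `hVs` VERBATIM as in ✓`UV3BranchExpansionGuardedTower.map_iterFrom_le_smul_of_branchExpansion`).  For a constrained set `s`, a branch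
set `s′ ⊆ s` and a site `σ = ⟨⟨κ, hκ⟩, c⟩ ∈ s` that is MUTE in `s` (for `σ ∈ s′` both sides coincide trivially, so `σ ∉ s′` is not assumed) — lattice data: the Dist-tower `t (κ+1) = c, t i = line (t (i+1)) (τ i)` (`κ+1 ≤ i ≤ m`, `m+1 ≤ n`) whose bonds
no guard of `s` at their height reads, and the exit chain `b (m+1) = t (m+1), b i = line (b (i+1)) (τ′ i)` of bonds unread by the guards of `s`, with parents OUTSIDE the slices of `s`
(✓`UV3BranchExpansionDistortedSet.exists_exit_chain`, re-indexed `i ↦ j+i`) — and every measurable `B`: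
**`dU_j ((⋂ τ ∈ s, {U | Small ℰ (V (insert σ s′) τ.1 U) τ.2}) ∩ V (insert σ s′) n ⁻¹' B) = dU_j ((⋂ τ ∈ s, {U | Small ℰ (V s′ τ.1 U) τ.2}) ∩ V s′ n ⁻¹' B)`**.
[cite: Balaban1987RG1, (0.4) p.253] -/
theorem socket_hM_of_mute (hE : ∀ m, Measurable fun W : Fin (m + 1) → G => ℰ.E W)
    (V : Finset (Σ i : Fin n, PBond P (j + i + 1)) → (i : ℕ) → GaugeField P j G → GaugeField P (j + i) G)
    (hV0 : ∀ s U, V s 0 U = U)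
    (hVs : ∀ s (i : ℕ) (hi : i < n) U, V s (i + 1) U = fun c =>
      if c ∈ (Finset.univ.filter fun c' => (⟨⟨i, hi⟩, c'⟩ : Σ i : Fin n, PBond P (j + i + 1)) ∈ s) then avgFun ℰ (V s i U) c else axialAvg (V s i U) c)
    (hjn : j + n ≤ P.m + P.K) (s s' : Finset (Σ i : Fin n, PBond P (j + i + 1))) (hs's : s' ⊆ s)
    {κ : ℕ} (hκ : κ < n) (c : PBond P (j + κ + 1)) (hσs : (⟨⟨κ, hκ⟩, c⟩ : Σ i : Fin n, PBond P (j + i + 1)) ∈ s)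
    {m : ℕ} (hκm : κ ≤ m) (hmn : m + 1 ≤ n)
    (t : (i : ℕ) → PBond P (j + i)) (τ : ℕ → ℕ) (htc : t (κ + 1) = c)
    (htower : ∀ i, κ + 1 ≤ i → i < m + 1 → τ i < P.L ∧ t i = line (t (i + 1)) (τ i))
    (htunread : ∀ (i : ℕ) (hi1 : κ + 1 ≤ i) (hi2 : i < m + 1), ∀ C : PBond P (j + i + 1),
      (⟨⟨i, by omega⟩, C⟩ : Σ i : Fin n, PBond P (j + i + 1)) ∈ s →
        ∀ (ι : Idx P), ∀ st ∈ walk (emb C.src) (loopWord P.L C.dir (off ι.1) ι.2.1 ι.2.2), st.bond ≠ t i)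
    (b : (i : ℕ) → PBond P (j + i)) (τ' : ℕ → ℕ) (hbt : b (m + 1) = t (m + 1))
    (hchain : ∀ i, i < m + 1 → τ' i < P.L ∧ b i = line (b (i + 1)) (τ' i))
    (hbax : ∀ (i : ℕ) (hi : i < m + 1), (⟨⟨i, by omega⟩, b (i + 1)⟩ : Σ i : Fin n, PBond P (j + i + 1)) ∉ s)
    (hbunread : ∀ (i : ℕ) (hi : i < m + 1), ∀ C : PBond P (j + i + 1),
      (⟨⟨i, by omega⟩, C⟩ : Σ i : Fin n, PBond P (j + i + 1)) ∈ s →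
        ∀ (ι : Idx P), ∀ st ∈ walk (emb C.src) (loopWord P.L C.dir (off ι.1) ι.2.1 ι.2.2), st.bond ≠ b i)
    {B : Set (GaugeField P (j + n) G)} (hB : MeasurableSet B) :
    fieldMeasure P j G ((⋂ τ ∈ s, {U : GaugeField P j G | Small ℰ (V (insert ⟨⟨κ, hκ⟩, c⟩ s') τ.1 U) τ.2}) ∩ V (insert ⟨⟨κ, hκ⟩, c⟩ s') n ⁻¹' B) =
      fieldMeasure P j G ((⋂ τ ∈ s, {U : GaugeField P j G | Small ℰ (V s' τ.1 U) τ.2}) ∩ V s' n ⁻¹' B) := by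
  -- the slice families of the three histories
  set σ : Σ i : Fin n, PBond P (j + i + 1) := ⟨⟨κ, hκ⟩, c⟩ with hσ
  set Sc : (i : ℕ) → Finset (PBond P (j + i + 1)) := fun i =>
    if hi : i < n then Finset.univ.filter fun c' => (⟨⟨i, hi⟩, c'⟩ : Σ i : Fin n, PBond P (j + i + 1)) ∈ s else ∅ with hSc
  set S₁ : (i : ℕ) → Finset (PBond P (j + i + 1)) := fun i =>
    if hi : i < n then Finset.univ.filter fun c' => (⟨⟨i, hi⟩, c'⟩ : Σ i : Fin n, PBond P (j + i + 1)) ∈ insert σ s' else ∅ with hS₁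
  set S₂ : (i : ℕ) → Finset (PBond P (j + i + 1)) := fun i =>
    if hi : i < n then Finset.univ.filter fun c' => (⟨⟨i, hi⟩, c'⟩ : Σ i : Fin n, PBond P (j + i + 1)) ∈ s' else ∅ with hS₂
  have memSc : ∀ (i : ℕ) (hi : i < n) (C : PBond P (j + i + 1)), C ∈ Sc i ↔ (⟨⟨i, hi⟩, C⟩ : Σ i : Fin n, PBond P (j + i + 1)) ∈ s := by
    intro i hi C; simp only [hSc, dif_pos hi, Finset.mem_filter, Finset.mem_univ, true_and]
  have memS₁ : ∀ (i : ℕ) (hi : i < n) (C : PBond P (j + i + 1)), C ∈ S₁ i ↔ (⟨⟨i, hi⟩, C⟩ : Σ i : Fin n, PBond P (j + i + 1)) ∈ insert σ s' := by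
    intro i hi C; simp only [hS₁, dif_pos hi, Finset.mem_filter, Finset.mem_univ, true_and]
  have memS₂ : ∀ (i : ℕ) (hi : i < n) (C : PBond P (j + i + 1)), C ∈ S₂ i ↔ (⟨⟨i, hi⟩, C⟩ : Σ i : Fin n, PBond P (j + i + 1)) ∈ s' := by
    intro i hi C; simp only [hS₂, dif_pos hi, Finset.mem_filter, Finset.mem_univ, true_and]
  -- two sites with different heights or different bonds are different
  have sigma_ne : ∀ (i : ℕ) (hi : i < n) (C : PBond P (j + i + 1)), (i ≠ κ ∨ (∃ h : i = κ, h ▸ C ≠ c)) →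
      (⟨⟨i, hi⟩, C⟩ : Σ i : Fin n, PBond P (j + i + 1)) ≠ σ := by
    intro i hi C h heq
    rw [hσ] at heq
    have h1 : (⟨i, hi⟩ : Fin n) = ⟨κ, hκ⟩ := congrArg Sigma.fst heq
    have hik : i = κ := congrArg Fin.val h1
    subst hik
    rcases h with h | ⟨_, h⟩
    · exact h rfl
    · exact h (eq_of_heq (Sigma.mk.inj_iff.1 heq).2)
  -- the hypotheses of §3 in the slice letters
  have hS₁c : ∀ i, i < n → S₁ i ⊆ Sc i := by
    intro i hi C hC
    rw [memSc i hi]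
    rcases Finset.mem_insert.1 ((memS₁ i hi C).1 hC) with h | h
    · rw [h]; exact hσs
    · exact hs's h
  have hS₂c : ∀ i, i < n → S₂ i ⊆ Sc i := fun i hi C hC => (memSc i hi C).2 (hs's ((memS₂ i hi C).1 hC))
  have hV₁s : ∀ i, i < n → ∀ U, V (insert σ s') (i + 1) U = fun C => if C ∈ S₁ i then avgFun ℰ (V (insert σ s') i U) C else axialAvg (V (insert σ s') i U) C := by
    intro i hi U
    have : S₁ i = Finset.univ.filter fun c' => (⟨⟨i, hi⟩, c'⟩ : Σ i : Fin n, PBond P (j + i + 1)) ∈ insert σ s' := by simp only [hS₁, dif_pos hi]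
    rw [this]; exact hVs _ i hi U
  have hV₂s : ∀ i, i < n → ∀ U, V s' (i + 1) U = fun C => if C ∈ S₂ i then avgFun ℰ (V s' i U) C else axialAvg (V s' i U) C := by
    intro i hi U
    have : S₂ i = Finset.univ.filter fun c' => (⟨⟨i, hi⟩, c'⟩ : Σ i : Fin n, PBond P (j + i + 1)) ∈ s' := by simp only [hS₂, dif_pos hi]
    rw [this]; exact hVs _ i hi U
  have hs : ∀ i, i ≠ κ → S₁ i = S₂ i := by
    intro i hiκ
    by_cases hi : i < n
    · ext C
      rw [memS₁ i hi, memS₂ i hi, Finset.mem_insert, or_iff_right]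
      exact sigma_ne i hi C (Or.inl hiκ)
    · simp only [hS₁, hS₂, dif_neg hi]
  have hsκ : ∀ C : PBond P (j + κ + 1), C ≠ c → (C ∈ S₁ κ ↔ C ∈ S₂ κ) := by
    intro C hC
    rw [memS₁ κ hκ, memS₂ κ hκ, Finset.mem_insert, or_iff_right]
    exact sigma_ne κ hκ C (Or.inr ⟨rfl, hC⟩)
  have htunread' : ∀ i, κ + 1 ≤ i → i < m + 1 → ∀ C ∈ Sc i, ∀ (ι : Idx P), ∀ st ∈ walk (emb C.src) (loopWord P.L C.dir (off ι.1) ι.2.1 ι.2.2), st.bond ≠ t i :=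
    fun i hi1 hi2 C hC => htunread i hi1 hi2 C ((memSc i (by omega) C).1 hC)
  have hbunread' : ∀ i, i < m + 1 → ∀ C ∈ Sc i, ∀ (ι : Idx P), ∀ st ∈ walk (emb C.src) (loopWord P.L C.dir (off ι.1) ι.2.1 ι.2.2), st.bond ≠ b i :=
    fun i hi C hC => hbunread i hi C ((memSc i (by omega) C).1 hC)
  have hbax₁ : ∀ i, i < m + 1 → b (i + 1) ∉ S₁ i := fun i hi h => hbax i hi ((memSc i (by omega) _).1 (hS₁c i (by omega) h))
  have hbax₂ : ∀ i, i < m + 1 → b (i + 1) ∉ S₂ i := fun i hi h => hbax i hi ((memSc i (by omega) _).1 (hS₂c i (by omega) h))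
  -- the events in the slice letters
  have hevent : ∀ s₀ : Finset (Σ i : Fin n, PBond P (j + i + 1)),
      (⋂ τ ∈ s, {U : GaugeField P j G | Small ℰ (V s₀ τ.1 U) τ.2}) = {U : GaugeField P j G | ∀ i, i < n → ∀ c' ∈ Sc i, Small ℰ (V s₀ i U) c'} := by
    intro s₀
    ext U
    simp only [Set.mem_iInter, Set.mem_setOf_eq]
    constructor
    · intro h i hi C hC
      exact h ⟨⟨i, hi⟩, C⟩ ((memSc i hi C).1 hC)
    · rintro h ⟨⟨i, hi⟩, C⟩ hτ
      exact h i hi C ((memSc i hi C).2 hτ)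
  rw [hevent, hevent]
  exact measure_guardAll_inter_preimage_eq_of_mute ℰ hE Sc S₁ S₂ hS₁c hS₂c (V (insert σ s')) (V s') (hV0 _) (hV0 _) hV₁s hV₂s hjn hκm hmn c hs hsκ
    t τ htc htower htunread' b τ' hbt hchain hbax₁ hbax₂ hbunread' hB

end Socket

end Summit.QuantumFields.YangMills.Theorems.UV3BranchExpansionMuteCancellation

end
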